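import Summits.Ventures.Crystal3D.Theorems.StickyWulffConstantGenericWallFloorRayAlignedCriteria
import HarnessLib

/-!
# Alignment is shallow: a steep pair that aligns at all aligns at ray depths `d₁ + d₂ ≤ |κ|`

HONEST FRAMING. Part of the venture `Summits/Ventures/Crystal3D` (cell `crystal3d-full`), helper `--supports` the
crux `GenericWallFloor` (stmt-Ventures-19480) of `route-Ventures-StickyWulffConstant`, registered line `WallLedgerG`,
open stub `stub_twoSlabAdhesion`; the planner's H-6 («is there a level bound for ray alignment?», cf-p1 (lxiii)(c)).
There is NO absolute bound on the length of the word of a ray-aligned pair (deep arrivals: `A₂` a deep node of a common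
ray of grain 1), but alignment is always witnessed SHALLOWLY relative to the word: if some chain frames of the steep pair
`(u₁, u₂)` are co-axial and `A₂·Λ₀ = (wordFrame A₁ κ)·Λ₀` with `κ` reduced admissible, then there are co-axial chain frames
at ray DEPTHS `d₁` (grain 1; `0` = the base, `k + 1` = level `k`) and `d₂` (grain 2) with `|κ| − 1 ≤ d₁ + d₂ ≤ |κ|`.
Hence `RayAlignedAt` for a pair presented by a word of length `n` is decided by the forced rays to depth `n`
(levels `< n`) — the finite check the certificate `ResidualOneSidedCoverage` performs per ν-box.

Mechanism (`…RayAlignedWord`, `…RayAlignedEnds`): the coincidence writes `A₂·Λ₀` through the raw word `γ ++ j ++ α`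
(`α` = grain 1's ray word, `γ` = grain 2's transported reversed ray word, `|j| ≤ 1`); reduction cancels only at the two
junctions (`junctions_structure`: `κ ≡ γ.take p ++ j' ++ α.drop q` with the PARTIAL identity
`wordFrame (γ.drop p ++ j ++ α) = wordFrame (j' ++ α.drop q)`), the surviving pieces are ray PREFIXES (`rayWord_drop`),
and the two prefix tips — depth `|α| − q` on grain 1, depth `p` on grain 2 — are equal or mirror twins
(`coaxial_of_image_eq_or_twin`).

* `wordFrame_reverse_cancel`, `wordFrame_congr_append`, `wordFrame_junction_partial`, **`junctions_structure`**,
  `rayWord_drop`, `image_wordFrame_of_transport`, **`exists_shallow_witness`**, **`exists_shallow_witness_of_rayAligned`**.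

WHAT THIS IS NOT: not the stub; no counting; F-C1 not moved; the uniform treatment of deep arrivals is separate.
-/

noncomputable section

namespace Summit.Ventures.Crystal3D.Theorems

open Summit.Ventures.Crystal3D Finset
open Literature.MathematicalPhysics.StatisticalMechanics (fccStacking barlowStacking IsHaggSeq)
open scoped InnerProductSpace

/-! ### Word algebra: cancellation in the middle -/

/-- `wordFrame B (δ.reverse ++ δ ++ rest) = wordFrame B rest`. -/
theorem wordFrame_reverse_cancel (B : EuclideanSpace ℝ (Fin 3) ≃ₗᵢ[ℝ] EuclideanSpace ℝ (Fin 3))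
    (δ rest : List (EuclideanSpace ℝ (Fin 3))) : wordFrame B (δ.reverse ++ δ ++ rest) = wordFrame B rest := by
  rw [wordFrame_append B (δ.reverse ++ δ) rest, wordFrame_reverse_append]

/-- Words with the same mirrors in front of a common tail have the same frame. -/
theorem wordFrame_congr_append (B : EuclideanSpace ℝ (Fin 3) ≃ₗᵢ[ℝ] EuclideanSpace ℝ (Fin 3))
    {γ η : List (EuclideanSpace ℝ (Fin 3))}
    (h : γ.map (fun μ => (ℝ ∙ μ)ᗮ.reflection) = η.map (fun μ => (ℝ ∙ μ)ᗮ.reflection))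
    (rest : List (EuclideanSpace ℝ (Fin 3))) : wordFrame B (γ ++ rest) = wordFrame B (η ++ rest) :=
  wordFrame_eq_of_map_eq B (by rw [List.map_append, List.map_append, h])

/-- **Partial cancellation at a junction.**  If the last `|γ| − p` letters of `γ` mirror the first `i` letters of `κ` in
reverse order, then `wordFrame B (γ.drop p ++ κ) = wordFrame B (κ.drop i)`. -/
theorem wordFrame_junction_partial (B : EuclideanSpace ℝ (Fin 3) ≃ₗᵢ[ℝ] EuclideanSpace ℝ (Fin 3))
    (γ κ : List (EuclideanSpace ℝ (Fin 3))) (p i : ℕ)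
    (hcan : (γ.drop p).map (fun μ => (ℝ ∙ μ)ᗮ.reflection) =
      ((κ.take i).reverse).map (fun μ => (ℝ ∙ μ)ᗮ.reflection)) :
    wordFrame B (γ.drop p ++ κ) = wordFrame B (κ.drop i) := by
  rw [wordFrame_congr_append B hcan κ]
  have hκ : (κ.take i).reverse ++ κ = (κ.take i).reverse ++ κ.take i ++ κ.drop i := by
    rw [List.append_assoc, List.take_append_drop]
  rw [hκ, wordFrame_reverse_cancel]

/-! ### Reduction cancels only at the junctions (with the partial identity) -/

/-- **Junction structure.**  For reduced menu words `γ`, `α` and a junction `j` of at most one menu letter there are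
`p ≤ |γ|`, `q ≤ |α|` and `j' ∈ {[], j}` such that `ρ := γ.take p ++ j' ++ α.drop q` is reduced,
`wordFrame B (γ ++ j ++ α) = wordFrame B ρ` and `wordFrame B (γ.drop p ++ j ++ α) = wordFrame B (j' ++ α.drop q)`. -/
theorem junctions_structure (B : EuclideanSpace ℝ (Fin 3) ≃ₗᵢ[ℝ] EuclideanSpace ℝ (Fin 3))
    (γ j α : List (EuclideanSpace ℝ (Fin 3)))
    (hl : ∀ μ ∈ γ ++ j ++ α, ‖μ‖ = 1 ∧
      ∀ w ∈ fccSlots, ⟪w, μ⟫_ℝ = 0 ∨ ⟪w, μ⟫_ℝ = Real.sqrt (2 / 3) ∨ ⟪w, μ⟫_ℝ = -Real.sqrt (2 / 3))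
    (hγc : List.IsChain (fun μ μ' => ⟪μ, μ'⟫_ℝ = 1 / 3 ∨ ⟪μ, μ'⟫_ℝ = -1 / 3) γ)
    (hαc : List.IsChain (fun μ μ' => ⟪μ, μ'⟫_ℝ = 1 / 3 ∨ ⟪μ, μ'⟫_ℝ = -1 / 3) α) (hj : j.length ≤ 1) :
    ∃ (p q : ℕ) (j' : List (EuclideanSpace ℝ (Fin 3))), p ≤ γ.length ∧ q ≤ α.length ∧ (j' = [] ∨ j' = j) ∧
      List.IsChain (fun μ μ' => ⟪μ, μ'⟫_ℝ = 1 / 3 ∨ ⟪μ, μ'⟫_ℝ = -1 / 3) (γ.take p ++ j' ++ α.drop q) ∧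
      wordFrame B (γ ++ j ++ α) = wordFrame B (γ.take p ++ j' ++ α.drop q) ∧
      wordFrame B (γ.drop p ++ j ++ α) = wordFrame B (j' ++ α.drop q) := by
  have hγl : ∀ μ ∈ γ, ‖μ‖ = 1 ∧
      ∀ w ∈ fccSlots, ⟪w, μ⟫_ℝ = 0 ∨ ⟪w, μ⟫_ℝ = Real.sqrt (2 / 3) ∨ ⟪w, μ⟫_ℝ = -Real.sqrt (2 / 3) :=
    fun μ hμ => hl μ (by simp [hμ])
  have hjl : ∀ μ ∈ j, ‖μ‖ = 1 ∧
      ∀ w ∈ fccSlots, ⟪w, μ⟫_ℝ = 0 ∨ ⟪w, μ⟫_ℝ = Real.sqrt (2 / 3) ∨ ⟪w, μ⟫_ℝ = -Real.sqrt (2 / 3) :=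
    fun μ hμ => hl μ (by simp [hμ])
  have hαl : ∀ μ ∈ α, ‖μ‖ = 1 ∧
      ∀ w ∈ fccSlots, ⟪w, μ⟫_ℝ = 0 ∨ ⟪w, μ⟫_ℝ = Real.sqrt (2 / 3) ∨ ⟪w, μ⟫_ℝ = -Real.sqrt (2 / 3) :=
    fun μ hμ => hl μ (by simp [hμ])
  -- chain-ness of takes and drops
  have take_chain : ∀ (l : List (EuclideanSpace ℝ (Fin 3))) (m : ℕ),
      List.IsChain (fun μ μ' => ⟪μ, μ'⟫_ℝ = 1 / 3 ∨ ⟪μ, μ'⟫_ℝ = -1 / 3) l →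
      List.IsChain (fun μ μ' => ⟪μ, μ'⟫_ℝ = 1 / 3 ∨ ⟪μ, μ'⟫_ℝ = -1 / 3) (l.take m) := by
    intro l m h
    have := h; rw [← List.take_append_drop m l] at this
    exact (List.isChain_append.1 this).1
  have drop_chain : ∀ (l : List (EuclideanSpace ℝ (Fin 3))) (m : ℕ),
      List.IsChain (fun μ μ' => ⟪μ, μ'⟫_ℝ = 1 / 3 ∨ ⟪μ, μ'⟫_ℝ = -1 / 3) l →
      List.IsChain (fun μ μ' => ⟪μ, μ'⟫_ℝ = 1 / 3 ∨ ⟪μ, μ'⟫_ℝ = -1 / 3) (l.drop m) := by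
    intro l m h
    have := h; rw [← List.take_append_drop m l] at this
    exact (List.isChain_append.1 this).2.1
  have hjc : List.IsChain (fun μ μ' => ⟪μ, μ'⟫_ℝ = 1 / 3 ∨ ⟪μ, μ'⟫_ℝ = -1 / 3) j := by
    match j, hj with
    | [], _ => exact List.isChain_nil
    | [x], _ => exact List.isChain_singleton x
  -- step 1: the junction `j | α`
  obtain ⟨j₀, hj₀α, hj₀j, hwf₁, hcan₁, hnc₁⟩ := junction_reduce B j.length j α rfl
  set j₁ := j.take (j.length - j₀) with hj₁
  set α₁ := α.drop j₀ with hα₁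
  have hρ₁c : List.IsChain (fun μ μ' => ⟪μ, μ'⟫_ℝ = 1 / 3 ∨ ⟪μ, μ'⟫_ℝ = -1 / 3) (j₁ ++ α₁) := by
    rw [List.isChain_append]
    exact ⟨take_chain j _ hjc, drop_chain α _ hαc, fun x hx y hy =>
      inner_third_of_reflection_ne (hjl x (List.mem_of_mem_take (List.mem_of_getLast? hx)))
        (hαl y (List.mem_of_mem_drop (List.mem_of_head? hy))) (hnc₁ x hx y hy)⟩
  have hρ₁l : ∀ μ ∈ j₁ ++ α₁, ‖μ‖ = 1 ∧
      ∀ w ∈ fccSlots, ⟪w, μ⟫_ℝ = 0 ∨ ⟪w, μ⟫_ℝ = Real.sqrt (2 / 3) ∨ ⟪w, μ⟫_ℝ = -Real.sqrt (2 / 3) := by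
    intro μ hμ
    rcases List.mem_append.1 hμ with h | h
    · exact hjl μ (List.mem_of_mem_take h)
    · exact hαl μ (List.mem_of_mem_drop h)
  -- step 2: the junction `γ | ρ₁`
  obtain ⟨j₂, hj₂ρ, hj₂γ, hwf₂, hcan₂, hnc₂⟩ := junction_reduce B γ.length γ (j₁ ++ α₁) rfl
  set p := γ.length - j₂ with hp
  -- the surviving junction and the number of cancelled letters of `α`
  refine ⟨p, min (j₀ + (j₂ - j₁.length)) α.length, j₁.drop j₂, by omega, min_le_right _ _, ?_, ?_, ?_, ?_⟩
  · -- `j₁.drop j₂ ∈ {[], j}`: a sublist of a list of length `≤ 1`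
    have hsub : List.Sublist (j₁.drop j₂) j := (List.drop_sublist _ _).trans (List.take_sublist _ _)
    rcases hcase : j₁.drop j₂ with _ | ⟨y, t⟩
    · exact Or.inl rfl
    · right
      rw [hcase] at hsub
      have hlen := hsub.length_le
      rw [List.length_cons] at hlen
      have ht : t = [] := List.eq_nil_of_length_eq_zero (by omega)
      obtain ⟨x, hx⟩ := List.length_eq_one_iff.1 (show j.length = 1 by omega)
      have hy : y ∈ j := hsub.subset List.mem_cons_self
      rw [hx, List.mem_singleton] at hy
      rw [ht, hy, hx]
  · -- reducedness of `γ.take p ++ j₁.drop j₂ ++ α.drop q`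
    have hsplit : (j₁ ++ α₁).drop j₂ = j₁.drop j₂ ++ α.drop (min (j₀ + (j₂ - j₁.length)) α.length) := by
      rw [List.drop_append, hα₁, List.drop_drop]
      congr 1
      rcases le_or_gt (j₀ + (j₂ - j₁.length)) α.length with h | h
      · rw [min_eq_left h]
      · rw [min_eq_right h.le, List.drop_eq_nil_of_le h.le, List.drop_length]
    have hc : List.IsChain (fun μ μ' => ⟪μ, μ'⟫_ℝ = 1 / 3 ∨ ⟪μ, μ'⟫_ℝ = -1 / 3)
        (γ.take p ++ (j₁ ++ α₁).drop j₂) := by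
      rw [List.isChain_append]
      exact ⟨take_chain γ _ hγc, drop_chain _ _ hρ₁c, fun x hx y hy =>
        inner_third_of_reflection_ne (hγl x (List.mem_of_mem_take (List.mem_of_getLast? hx)))
          (hρ₁l y (List.mem_of_mem_drop (List.mem_of_head? hy))) (hnc₂ x hx y hy)⟩
    rw [hsplit, ← List.append_assoc] at hc
    exact hc
  · -- the total frame
    have hsplit : (j₁ ++ α₁).drop j₂ = j₁.drop j₂ ++ α.drop (min (j₀ + (j₂ - j₁.length)) α.length) := by
      rw [List.drop_append, hα₁, List.drop_drop]
      congr 1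
      rcases le_or_gt (j₀ + (j₂ - j₁.length)) α.length with h | h
      · rw [min_eq_left h]
      · rw [min_eq_right h.le, List.drop_eq_nil_of_le h.le, List.drop_length]
    rw [List.append_assoc, wordFrame_append B γ (j ++ α), hwf₁, ← wordFrame_append, hwf₂, hsplit,
      List.append_assoc]
  · -- the partial identity
    have hsplit : (j₁ ++ α₁).drop j₂ = j₁.drop j₂ ++ α.drop (min (j₀ + (j₂ - j₁.length)) α.length) := by
      rw [List.drop_append, hα₁, List.drop_drop]
      congr 1
      rcases le_or_gt (j₀ + (j₂ - j₁.length)) α.length with h | h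
      · rw [min_eq_left h]
      · rw [min_eq_right h.le, List.drop_eq_nil_of_le h.le, List.drop_length]
    rw [List.append_assoc, wordFrame_append B (γ.drop p) (j ++ α), hwf₁, ← wordFrame_append,
      wordFrame_junction_partial B γ (j₁ ++ α₁) p j₂ hcan₂, hsplit]

/-! ### Ray prefixes -/

/-- Dropping the most recent letters of a ray word gives a shorter ray word. -/
theorem rayWord_drop (z : EuclideanSpace ℝ (Fin 3)) (b : WalkEntry) (n : EuclideanSpace ℝ (Fin 3)) {m i : ℕ}
    (hi : i ≤ m) : (rayWord z b n m).drop i = rayWord z b n (m - i) := by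
  obtain ⟨w, hw, hl⟩ := rayWord_eq_append z b n (m - i) i
  rw [show m - i + i = m by omega] at hw
  rw [hw, List.drop_append_of_le_length (by rw [hl]), List.drop_eq_nil_of_le (by rw [hl]), List.nil_append]

/-- The frame of a ray prefix of depth `d`: the base for `d = 0`, level `d − 1` otherwise; it is a chain frame when the
first push normal is admissible. -/
theorem exists_chainFrame_of_rayWord (z : EuclideanSpace ℝ (Fin 3))
    {A : EuclideanSpace ℝ (Fin 3) ≃ₗᵢ[ℝ] EuclideanSpace ℝ (Fin 3)} {u n : EuclideanSpace ℝ (Fin 3)} (hn : ‖n‖ = 1)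
    (hmenu : ∀ w ∈ fccSlots, ⟪A w, n⟫_ℝ = 0 ∨ ⟪A w, n⟫_ℝ = Real.sqrt (2 / 3) ∨ ⟪A w, n⟫_ℝ = -Real.sqrt (2 / 3))
    (hpos : ⟪A u, n⟫_ℝ = Real.sqrt (2 / 3)) (d : ℕ) :
    ∃ G ∈ chainFrames z A u, G = wordFrame A (rayWord z ⟨A, u, 0⟩ n d) ∧
      (d = 0 ∧ G = A ∨ 0 < d ∧ G = (forcedTop z ⟨A, u, 0⟩ n (d - 1)).frame) := by
  rcases d with _ | k
  · exact ⟨A, self_mem_chainFrames z A u, rfl, Or.inl ⟨rfl, rfl⟩⟩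
  · refine ⟨(forcedTop z ⟨A, u, 0⟩ n k).frame, Or.inr ⟨n, hn, hmenu, hpos, k, rfl⟩,
      forcedTop_frame_eq_wordFrame z ⟨A, u, 0⟩ hn hmenu k, Or.inr ⟨Nat.succ_pos k, by simp⟩⟩

/-- Transport of a word over `A₂` through `A₂ = S ≫ Φ`: `(wordFrame A₂ δ)·Λ₀ = (wordFrame Φ (δ.map S))·Λ₀`. -/
theorem image_wordFrame_of_transport {A₂ Φ S : EuclideanSpace ℝ (Fin 3) ≃ₗᵢ[ℝ] EuclideanSpace ℝ (Fin 3)}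
    (hS : S '' fccStacking 1 (Real.sqrt (2 / 3)) = fccStacking 1 (Real.sqrt (2 / 3))) (hSx : ∀ x, Φ (S x) = A₂ x)
    (δ : List (EuclideanSpace ℝ (Fin 3))) (hδ : ∀ μ ∈ δ, ‖μ‖ = 1) :
    (wordFrame A₂ δ) '' fccStacking 1 (Real.sqrt (2 / 3)) =
      (wordFrame Φ (δ.map S)) '' fccStacking 1 (Real.sqrt (2 / 3)) := by
  have hA₂ : A₂ = S.trans Φ := LinearIsometryEquiv.ext fun x => by rw [LinearIsometryEquiv.trans_apply, hSx]
  rw [hA₂, wordFrame_trans Φ S δ hδ, image_trans_eq, hS]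


/-- **Ray data of a chain frame.**  A chain frame is `wordFrame A α` for a reduced admissible `α` all of whose
SUFFIXES (the ray prefixes) are chain frames, at depth `d` = the number of surviving letters. -/
theorem exists_rayData {z : EuclideanSpace ℝ (Fin 3)} {A F : EuclideanSpace ℝ (Fin 3) ≃ₗᵢ[ℝ] EuclideanSpace ℝ (Fin 3)}
    {u : EuclideanSpace ℝ (Fin 3)} (hF : F ∈ chainFrames z A u) :
    ∃ α : List (EuclideanSpace ℝ (Fin 3)), F = wordFrame A α ∧
      (∀ μ ∈ α, ‖μ‖ = 1 ∧
        ∀ w ∈ fccSlots, ⟪w, μ⟫_ℝ = 0 ∨ ⟪w, μ⟫_ℝ = Real.sqrt (2 / 3) ∨ ⟪w, μ⟫_ℝ = -Real.sqrt (2 / 3)) ∧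
      List.IsChain (fun μ μ' => ⟪μ, μ'⟫_ℝ = 1 / 3 ∨ ⟪μ, μ'⟫_ℝ = -1 / 3) α ∧
      ∀ d : ℕ, d ≤ α.length → ∃ G ∈ chainFrames z A u, G = wordFrame A (α.drop (α.length - d)) ∧
        (d = 0 ∧ G = A ∨ ∃ n : EuclideanSpace ℝ (Fin 3), ‖n‖ = 1 ∧
          (∀ w ∈ fccSlots, ⟪A w, n⟫_ℝ = 0 ∨ ⟪A w, n⟫_ℝ = Real.sqrt (2 / 3) ∨ ⟪A w, n⟫_ℝ = -Real.sqrt (2 / 3)) ∧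
          ⟪A u, n⟫_ℝ = Real.sqrt (2 / 3) ∧ 0 < d ∧ G = (forcedTop z ⟨A, u, 0⟩ n (d - 1)).frame) := by
  rcases hF with rfl | ⟨n, hn, hmenu, hpos, k, rfl⟩
  · refine ⟨[], rfl, fun μ hμ => by simp at hμ, List.isChain_nil, fun d hd => ?_⟩
    have hd0 : d = 0 := by simpa using hd
    subst hd0
    exact ⟨_, self_mem_chainFrames z _ u, rfl, Or.inl ⟨rfl, rfl⟩⟩
  · refine ⟨rayWord z ⟨A, u, 0⟩ n (k + 1), forcedTop_frame_eq_wordFrame z ⟨A, u, 0⟩ hn hmenu k,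
      (rayWord_letters z ⟨A, u, 0⟩ hn hmenu k).1, rayWord_isChain z ⟨A, u, 0⟩ hn hmenu k, fun d hd => ?_⟩
    rw [length_rayWord] at hd
    obtain ⟨G, hG, hGw, hGd⟩ := exists_chainFrame_of_rayWord z hn hmenu hpos d
    refine ⟨G, hG, ?_, hGd.imp id fun h => ⟨n, hn, hmenu, hpos, h.1, h.2⟩⟩
    rw [hGw, length_rayWord, rayWord_drop z ⟨A, u, 0⟩ n (by omega : k + 1 - d ≤ k + 1),
      show k + 1 - (k + 1 - d) = d by omega]

/-- **Alignment is shallow.**  If `A₂·Λ₀ = (wordFrame A₁ κ)·Λ₀` for a reduced admissible word `κ` and SOME chain frames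
of the steep pair `(u₁, u₂)` are co-axial, then chain frames at ray depths `d₁`, `d₂` with `|κ| ≤ d₁ + d₂ + 1` and
`d₁ + d₂ ≤ |κ|` are co-axial (`d = 0`: the base frame; `d = k + 1`: level `k` of a forced ray). -/
theorem exists_shallow_witness {z₁ z₂ : EuclideanSpace ℝ (Fin 3)}
    {A₁ A₂ F₁ F₂ : EuclideanSpace ℝ (Fin 3) ≃ₗᵢ[ℝ] EuclideanSpace ℝ (Fin 3)} {u₁ u₂ : EuclideanSpace ℝ (Fin 3)}
    {κ : List (EuclideanSpace ℝ (Fin 3))}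
    (hκl : ∀ μ ∈ κ, ‖μ‖ = 1 ∧
      ∀ w ∈ fccSlots, ⟪w, μ⟫_ℝ = 0 ∨ ⟪w, μ⟫_ℝ = Real.sqrt (2 / 3) ∨ ⟪w, μ⟫_ℝ = -Real.sqrt (2 / 3))
    (hκc : List.IsChain (fun μ μ' => ⟪μ, μ'⟫_ℝ = 1 / 3 ∨ ⟪μ, μ'⟫_ℝ = -1 / 3) κ)
    (hA₂ : A₂ '' fccStacking 1 (Real.sqrt (2 / 3)) = (wordFrame A₁ κ) '' fccStacking 1 (Real.sqrt (2 / 3)))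
    (hF₁ : F₁ ∈ chainFrames z₁ A₁ u₁) (hF₂ : F₂ ∈ chainFrames z₂ A₂ u₂)
    (hco : ∃ (L : EuclideanSpace ℝ (Fin 3) ≃ₗᵢ[ℝ] EuclideanSpace ℝ (Fin 3))
        (s₁ s₂ : EuclideanSpace ℝ (Fin 3)) (σ σ' : ℤ → ℤ), IsHaggSeq σ ∧ IsHaggSeq σ' ∧
        F₁ '' fccStacking 1 (Real.sqrt (2 / 3)) ⊆ (fun p => L p + s₁) '' barlowStacking 1 (Real.sqrt (2 / 3)) σ ∧
        F₂ '' fccStacking 1 (Real.sqrt (2 / 3)) ⊆ (fun p => L p + s₂) '' barlowStacking 1 (Real.sqrt (2 / 3)) σ') :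
    ∃ d₁ d₂ : ℕ, d₁ + d₂ ≤ κ.length ∧ κ.length ≤ d₁ + d₂ + 1 ∧
      ∃ G₁ ∈ chainFrames z₁ A₁ u₁, ∃ G₂ ∈ chainFrames z₂ A₂ u₂,
        (d₁ = 0 ∧ G₁ = A₁ ∨ ∃ n₁ : EuclideanSpace ℝ (Fin 3), ‖n₁‖ = 1 ∧
          (∀ w ∈ fccSlots, ⟪A₁ w, n₁⟫_ℝ = 0 ∨ ⟪A₁ w, n₁⟫_ℝ = Real.sqrt (2 / 3) ∨ ⟪A₁ w, n₁⟫_ℝ = -Real.sqrt (2 / 3)) ∧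
          ⟪A₁ u₁, n₁⟫_ℝ = Real.sqrt (2 / 3) ∧ 0 < d₁ ∧ G₁ = (forcedTop z₁ ⟨A₁, u₁, 0⟩ n₁ (d₁ - 1)).frame) ∧
        (d₂ = 0 ∧ G₂ = A₂ ∨ ∃ n₂ : EuclideanSpace ℝ (Fin 3), ‖n₂‖ = 1 ∧
          (∀ w ∈ fccSlots, ⟪A₂ w, n₂⟫_ℝ = 0 ∨ ⟪A₂ w, n₂⟫_ℝ = Real.sqrt (2 / 3) ∨ ⟪A₂ w, n₂⟫_ℝ = -Real.sqrt (2 / 3)) ∧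
          ⟪A₂ u₂, n₂⟫_ℝ = Real.sqrt (2 / 3) ∧ 0 < d₂ ∧ G₂ = (forcedTop z₂ ⟨A₂, u₂, 0⟩ n₂ (d₂ - 1)).frame) ∧
        ∃ (L : EuclideanSpace ℝ (Fin 3) ≃ₗᵢ[ℝ] EuclideanSpace ℝ (Fin 3))
          (s₁ s₂ : EuclideanSpace ℝ (Fin 3)) (σ σ' : ℤ → ℤ), IsHaggSeq σ ∧ IsHaggSeq σ' ∧
          G₁ '' fccStacking 1 (Real.sqrt (2 / 3)) ⊆ (fun p => L p + s₁) '' barlowStacking 1 (Real.sqrt (2 / 3)) σ ∧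
          G₂ '' fccStacking 1 (Real.sqrt (2 / 3)) ⊆ (fun p => L p + s₂) '' barlowStacking 1 (Real.sqrt (2 / 3)) σ' := by
  obtain ⟨α, hF₁α, hαl, hαc, hray₁⟩ := exists_rayData hF₁
  obtain ⟨β, hF₂β, hβl, hβc, hray₂⟩ := exists_rayData hF₂
  obtain ⟨S, γ, j, hS, hγ, hj, hγjl, hSx, himg⟩ := exists_word_of_coaxial_wordFrames hF₁α hF₂β hβl hco
  have hl : ∀ μ ∈ γ ++ j ++ α, ‖μ‖ = 1 ∧
      ∀ w ∈ fccSlots, ⟪w, μ⟫_ℝ = 0 ∨ ⟪w, μ⟫_ℝ = Real.sqrt (2 / 3) ∨ ⟪w, μ⟫_ℝ = -Real.sqrt (2 / 3) := by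
    intro μ hμ
    rcases List.mem_append.1 hμ with h | h
    · exact hγjl μ h
    · exact hαl μ h
  have hγc : List.IsChain (fun μ μ' => ⟪μ, μ'⟫_ℝ = 1 / 3 ∨ ⟪μ, μ'⟫_ℝ = -1 / 3) γ := by
    rw [hγ]; exact isChain_reverse_map S hβc
  have hjlen : j.length ≤ 1 := by
    rcases hj with rfl | ⟨m, -, -, rfl⟩ <;> simp
  have hγlen : γ.length = β.length := by rw [hγ, List.length_map, List.length_reverse]
  obtain ⟨p, q, j', hp, hq, hj', hρc, hwf, hpartial⟩ := junctions_structure A₁ γ j α hl hγc hαc hjlen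
  -- letters of the reduced form
  have hj'sub : ∀ μ ∈ j', μ ∈ j := by
    rcases hj' with rfl | rfl
    · intro μ hμ; simp at hμ
    · exact fun μ hμ => hμ
  have hρl : ∀ μ ∈ γ.take p ++ j' ++ α.drop q, ‖μ‖ = 1 ∧
      ∀ w ∈ fccSlots, ⟪w, μ⟫_ℝ = 0 ∨ ⟪w, μ⟫_ℝ = Real.sqrt (2 / 3) ∨ ⟪w, μ⟫_ℝ = -Real.sqrt (2 / 3) := by
    intro μ hμ
    rcases List.mem_append.1 hμ with h | h
    · rcases List.mem_append.1 h with h' | h'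
      · exact hl μ (by simp [List.mem_of_mem_take h'])
      · exact hl μ (by simp [hj'sub μ h'])
    · exact hl μ (by simp [List.mem_of_mem_drop h])
  -- rigidity: `κ` has the mirrors of the reduced form, in particular its length
  have himgs : (wordFrame A₁ κ : EuclideanSpace ℝ (Fin 3) → EuclideanSpace ℝ (Fin 3)) '' ↑fccSlots =
      (wordFrame A₁ (γ.take p ++ j' ++ α.drop q) : EuclideanSpace ℝ (Fin 3) → EuclideanSpace ℝ (Fin 3)) ''
        ↑fccSlots :=
    image_fccSlots_eq_of_image_fcc_eq _ _ (by rw [← hA₂, himg, hwf])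
  have hmap := map_reflection_eq_of_image_eq A₁ hκl hκc hρl hρc himgs
  have hj'len : j'.length ≤ 1 := by
    rcases hj' with rfl | rfl
    · simp
    · exact hjlen
  have hlen : κ.length = p + j'.length + (α.length - q) := by
    have h := congrArg List.length hmap
    rw [List.length_map, List.length_map, List.length_append, List.length_append, List.length_take,
      List.length_drop, min_eq_left hp] at h
    exact h
  refine ⟨α.length - q, p, by omega, by omega, ?_⟩
  -- the two tips
  obtain ⟨G₁, hG₁, hG₁w, hG₁d⟩ := hray₁ (α.length - q) (Nat.sub_le _ _)
  rw [show α.length - (α.length - q) = q by omega] at hG₁w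
  obtain ⟨G₂, hG₂, hG₂w, hG₂d⟩ := hray₂ p (by rw [← hγlen]; exact hp)
  refine ⟨G₁, hG₁, G₂, hG₂, hG₁d, hG₂d, ?_⟩
  -- the lattice of the grain-2 tip, transported: `G₂·Λ₀ = (wordFrame A₁ (j' ++ α.drop q))·Λ₀`
  set δ := β.drop (β.length - p) with hδ
  have hδl : ∀ μ ∈ δ, ‖μ‖ = 1 := fun μ hμ => (hβl μ (List.mem_of_mem_drop hμ)).1
  have hδlen : (δ.map S).length = p := by
    rw [List.length_map, hδ, List.length_drop]; omega
  have hγsplit : γ = (δ.map S).reverse ++ γ.drop p := by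
    have h1 : γ = (δ.map S).reverse ++ ((β.take (β.length - p)).reverse).map S := by
      rw [hγ, ← List.map_reverse, ← List.map_append, ← List.reverse_append, List.take_append_drop]
    have h2 : γ.drop p = ((β.take (β.length - p)).reverse).map S := by
      conv_lhs => rw [h1]
      rw [← hδlen, ← List.length_reverse, List.drop_left]
    rw [h2]; exact h1
  have hG₂img : G₂ '' fccStacking 1 (Real.sqrt (2 / 3)) =
      (wordFrame A₁ (j' ++ α.drop q)) '' fccStacking 1 (Real.sqrt (2 / 3)) := by
    rw [hG₂w, image_wordFrame_of_transport hS hSx δ hδl, ← wordFrame_append, ← hpartial]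
    congr 2
    conv_lhs => rw [hγsplit]
    rw [show δ.map S ++ (((δ.map S).reverse ++ γ.drop p) ++ j ++ α) =
        ((δ.map S).reverse).reverse ++ (δ.map S).reverse ++ (γ.drop p ++ j ++ α) by
      rw [List.reverse_reverse]; simp only [List.append_assoc]]
    rw [wordFrame_reverse_cancel]
  -- equal or twin
  refine coaxial_of_image_eq_or_twin G₁ G₂ ?_
  rcases hj' with rfl | rfl
  · left; rw [hG₂img, hG₁w, List.nil_append]
  · -- `j' = j`: empty or one junction letter
    rcases hj with rfl | ⟨m, -, -, rfl⟩
    · left; rw [hG₂img, hG₁w, List.nil_append]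
    · right
      set x := F₁.symm m with hx
      obtain ⟨hx1, hxm⟩ := hl x (by simp)
      refine ⟨G₁ x, by rw [LinearIsometryEquiv.norm_map, hx1], menu_frame_of_model G₁ hxm, ?_⟩
      rw [hG₂img, ← wordFrame_singleton_eq_twinFrame G₁ hx1, hG₁w, ← wordFrame_append]

/-- **`RayAlignedAt` is decided at depth `|κ|`.**  For a ray-aligned pair presented by the reduced admissible word `κ`,
every steep pair of slots has co-axial chain frames at ray depths `d₁ + d₂ ≤ |κ|`. -/
theorem exists_shallow_witness_of_rayAlignedAt {A₁ A₂ : EuclideanSpace ℝ (Fin 3) ≃ₗᵢ[ℝ] EuclideanSpace ℝ (Fin 3)}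
    {κ : List (EuclideanSpace ℝ (Fin 3))}
    (hκl : ∀ μ ∈ κ, ‖μ‖ = 1 ∧
      ∀ w ∈ fccSlots, ⟪w, μ⟫_ℝ = 0 ∨ ⟪w, μ⟫_ℝ = Real.sqrt (2 / 3) ∨ ⟪w, μ⟫_ℝ = -Real.sqrt (2 / 3))
    (hκc : List.IsChain (fun μ μ' => ⟪μ, μ'⟫_ℝ = 1 / 3 ∨ ⟪μ, μ'⟫_ℝ = -1 / 3) κ)
    (hA₂ : A₂ '' fccStacking 1 (Real.sqrt (2 / 3)) = (wordFrame A₁ κ) '' fccStacking 1 (Real.sqrt (2 / 3)))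
    (hray : RayAlignedAt A₁ A₂) {u₁ u₂ : EuclideanSpace ℝ (Fin 3)} (hu₁ : u₁ ∈ fccSlots)
    (hs₁ : Real.sqrt 2 / 2 ≤ ⟪A₁ u₁, EuclideanSpace.single (2 : Fin 3) (1 : ℝ)⟫_ℝ) (hu₂ : u₂ ∈ fccSlots)
    (hs₂ : ⟪A₂ u₂, EuclideanSpace.single (2 : Fin 3) (1 : ℝ)⟫_ℝ ≤ -(Real.sqrt 2 / 2)) :
    ∃ d₁ d₂ : ℕ, d₁ + d₂ ≤ κ.length ∧ κ.length ≤ d₁ + d₂ + 1 ∧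
      ∃ G₁ ∈ chainFrames (EuclideanSpace.single (2 : Fin 3) (1 : ℝ)) A₁ u₁,
      ∃ G₂ ∈ chainFrames (-EuclideanSpace.single (2 : Fin 3) (1 : ℝ)) A₂ u₂,
        (d₁ = 0 ∧ G₁ = A₁ ∨ ∃ n₁ : EuclideanSpace ℝ (Fin 3), ‖n₁‖ = 1 ∧
          (∀ w ∈ fccSlots, ⟪A₁ w, n₁⟫_ℝ = 0 ∨ ⟪A₁ w, n₁⟫_ℝ = Real.sqrt (2 / 3) ∨ ⟪A₁ w, n₁⟫_ℝ = -Real.sqrt (2 / 3)) ∧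
          ⟪A₁ u₁, n₁⟫_ℝ = Real.sqrt (2 / 3) ∧ 0 < d₁ ∧
          G₁ = (forcedTop (EuclideanSpace.single (2 : Fin 3) (1 : ℝ)) ⟨A₁, u₁, 0⟩ n₁ (d₁ - 1)).frame) ∧
        (d₂ = 0 ∧ G₂ = A₂ ∨ ∃ n₂ : EuclideanSpace ℝ (Fin 3), ‖n₂‖ = 1 ∧
          (∀ w ∈ fccSlots, ⟪A₂ w, n₂⟫_ℝ = 0 ∨ ⟪A₂ w, n₂⟫_ℝ = Real.sqrt (2 / 3) ∨ ⟪A₂ w, n₂⟫_ℝ = -Real.sqrt (2 / 3)) ∧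
          ⟪A₂ u₂, n₂⟫_ℝ = Real.sqrt (2 / 3) ∧ 0 < d₂ ∧
          G₂ = (forcedTop (-EuclideanSpace.single (2 : Fin 3) (1 : ℝ)) ⟨A₂, u₂, 0⟩ n₂ (d₂ - 1)).frame) ∧
        ∃ (L : EuclideanSpace ℝ (Fin 3) ≃ₗᵢ[ℝ] EuclideanSpace ℝ (Fin 3))
          (s₁ s₂ : EuclideanSpace ℝ (Fin 3)) (σ σ' : ℤ → ℤ), IsHaggSeq σ ∧ IsHaggSeq σ' ∧
          G₁ '' fccStacking 1 (Real.sqrt (2 / 3)) ⊆ (fun p => L p + s₁) '' barlowStacking 1 (Real.sqrt (2 / 3)) σ ∧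
          G₂ '' fccStacking 1 (Real.sqrt (2 / 3)) ⊆ (fun p => L p + s₂) '' barlowStacking 1 (Real.sqrt (2 / 3)) σ' := by
  obtain ⟨F₁, hF₁, F₂, hF₂, hco⟩ := hray u₁ hu₁ hs₁ u₂ hu₂ hs₂
  exact exists_shallow_witness hκl hκc hA₂ hF₁ hF₂ hco

end Summit.Ventures.Crystal3D.Theorems

end
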